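import Summits.NavierStokesRegularity.NavierStokesRegularity.Theorems.ScaledTopAlignmentFlexibleZoom
import Summits.NavierStokesRegularity.NavierStokesRegularity.Theorems.ScaledTopAlignmentMostTimesWindowAt
import Summits.NavierStokesRegularity.NavierStokesRegularity.Theorems.ScaledTopAlignmentMostTimesEnd
import Summits.NavierStokesRegularity.NavierStokesRegularity.Theorems.LocalSineTubeDoorProfileAlignedWindowRigidity
import Summits.NavierStokesRegularity.NavierStokesRegularity.Theorems.SymmetryModuliCountLiouvilleKillsTypeI
import Summits.NavierStokesRegularity.NavierStokesRegularity.Theorems.IsobarTomographyTubeAlternativeStubTwoSidedVorticityRate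
import Summits.NavierStokesRegularity.NavierStokesRegularity.Theses.TypeILiouville
import Literature.Analysis.FluidPDE.VorticityCalculus
import HarnessLib
/-!
# Route `ScaledTopAlignment`: GLUE KIT for the SCALE-SEQUENCE near-maximum window-bulk door — the
# exceptional time sets need final density `≤ θ` only along ONE SEQUENCE of final scales `h_k → 0`
# chosen per solution (support for the deciding crux W3ᵐᵗ = `AprioriMostTimesBulkAlignment`,
# stmt-NavierStokesRegularity-19551, and its weakenings; no import of the route file)

Sibling of `ScaledTopAlignmentNearMaxMostTimesGlueKit`. There the exceptional time sets `E` must have density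
`≤ θ` in EVERY short final interval `(T − h, T)`, `h < h₀(E)`; here only in the intervals `(T − h_k, T)`
along one sequence `h_k → 0⁺` fixed per solution before `κ, q, ε, δ` ("good windows infinitely often", a
liminf-type density instead of a limsup-type one). Two changes in the argument:

* the flexible zoom is run with CALLER-CHOSEN base times `τ_j = T − h_j` (the freedom built into
  `typeIZoom_ancientMild_limit_flexible` for exactly this purpose), so that the `j`-th zoom scale
  `λ_j²/ν = h_j` IS a good scale;
* the slice interval is the FIXED `[−1, −1/N]` (`N(1 − θ) > 1`), on which every slice vorticity of the
  limit `W` is somewhere non-zero by the tree's BACKWARD UNIQUENESS for the class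
  (`TubeAlternative.AnalyticPropagation.curl_eq_zero_of_curl_slice_eq_zero` /
  `slice_eq_zero_of_curl_slice_eq_zero`: an irrotational slice `s₀` makes all slices `≤ s₀` vanish,
  contradicting `W(−1, 0) ≠ 0`) — no far-past end is needed, so the zoom times
  `T − h_j(−s)`, `s ∈ (−1, −1/N]`, stay inside the good window `(T − h_j, T)`.
Everything else (uniform floor, diagonal over levels, slice selection, window lemma read at the
preimages, LocalSineTubeDoor rigidity, both near-maximum premises discharged via the upper Type-I
vorticity law) is as in the sibling. Main: `false_of_scaleSeqNearMaxBulkAligned_typeI`; bridge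
`navierStokesRegularity_of_scaleSeqNearMaxBulkAlignment_of_noTypeII`. Door shape (per solution):
`∃ λ₀<1 ∃ R₀>0 ∃ θ<1 ∃ (h_k > 0) → 0, ∀ κ>0 ∀ q>0 ∀ ε>0 ∀ δ>0 ∃ M>0 ∃ E (∀ k, |E ∩ (T−h_k,T)| ≤ θ h_k)
∀ t ∈ [0,T) ∖ E ∀ x, M ≤ |ω| → κ/(T−t) ≤ |ω| → (∀ x′, q|ω(t,x′)| ≤ |ω(t,x)|) → volume(…) ≤ δℓ³`.
WHAT THIS IS NOT: not NS regularity; nothing here proves any door; NoTypeII stays the residual hard core.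
References: Giga–Miura, CMP 303 (2011) = HUPS #956, Thm 1.1, Rmk 1.4, §2.1 [GigaMiura2011]; KNSS, Acta
Math. 203 (2009), Prop. 4.1, Thm 5.1, §6, Remark 6.1 [KochNadirashviliSereginSverak2009];
Escauriaza–Seregin–Šverák 2003 (backward uniqueness) [EscauriazaSereginSverak2003].
-/

noncomputable section
-- the summit and its single sub-problem share the name (CONVENTIONS §1), as in every Theorems file
set_option linter.dupNamespace false
open MeasureTheory Set Function Filter Topology Metric
open scoped RealInnerProductSpace ENNReal
namespace Summit.NavierStokesRegularity.NavierStokesRegularity.Theorems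
open Literature.Analysis Literature.Analysis.FluidPDE
open Summit.NavierStokesRegularity.NavierStokesRegularity.Theorems.LocalSineTubeDoorProfileAlignedWindowRigidity
open Summit.NavierStokesRegularity.NavierStokesRegularity.Theorems.TubeAlternative.AnalyticPropagation

/-- **Slice selection at one scale.** If `volume (E ∩ (T − μ|a|, T)) ≤ θ μ|a|` and `θ|a| < b − a`
(`a < b < 0`, `μ > 0`), some slice `s ∈ (a, b]` has `T + μ s ∉ E`. (`exists_slice_time_notMem` with the
density hypothesis at the single scale that is used.) [folklore] -/
theorem exists_slice_time_notMem_scale {T μ a b θ : ℝ} {E : Set ℝ} (hμ : 0 < μ) (hab : a < b)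
    (hb : b < 0) (hθab : θ * (-a) < b - a)
    (hE : volume (E ∩ Ioo (T - μ * (-a)) T) ≤ ENNReal.ofReal (θ * (μ * (-a)))) :
    ∃ s ∈ Ioc a b, T + μ * s ∉ E := by
  by_contra hno
  push Not at hno
  have hsub : Ioc (T + μ * a) (T + μ * b) ⊆ E ∩ Ioo (T - μ * (-a)) T := by
    intro t ht
    refine ⟨?_, by linarith [ht.1], ?_⟩
    · have hs : (t - T) / μ ∈ Ioc a b :=
        ⟨by rw [lt_div_iff₀ hμ]; linarith [ht.1], by rw [div_le_iff₀ hμ]; linarith [ht.2]⟩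
      have h := hno _ hs
      have e : T + μ * ((t - T) / μ) = t := by field_simp; ring
      rwa [e] at h
    · have : μ * b < 0 := mul_neg_of_pos_of_neg hμ hb
      linarith [ht.2]
  have hvol : volume (Ioc (T + μ * a) (T + μ * b)) = ENNReal.ofReal (μ * (b - a)) := by
    rw [Real.volume_Ioc]; congr 1; ring
  have hle : ENNReal.ofReal (μ * (b - a)) ≤ ENNReal.ofReal (θ * (μ * (-a))) := by
    rw [← hvol]; exact (measure_mono hsub).trans hE
  have hlt : θ * (μ * (-a)) < μ * (b - a) := by
    have := mul_lt_mul_of_pos_left hθab hμ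
    linarith [show θ * (μ * (-a)) = μ * (θ * (-a)) by ring]
  exact absurd hle (not_le.2 ((ENNReal.ofReal_lt_ofReal_iff (mul_pos hμ (by linarith))).2 hlt))

set_option maxHeartbeats 800000 in
/-- **A scale-sequence near-maximum window-bulk door kills Type-I blow-up.** As
`false_of_nearMaxMostTimesBulkAligned_typeI`, with the density of the exceptional sets required only
along a sequence of final scales `h_k → 0⁺` given in advance; the zoom is based at the times `T − h_k`
and the slices range over the fixed interval `[−1, −1/N]`, where backward uniqueness keeps the limit
vorticity non-zero. [cite: GigaMiura2011, Thm 1.1 with Rmk 1.4 and §2.1 (HUPS preprint #956 pp. 3–9)] -/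
theorem false_of_scaleSeqNearMaxBulkAligned_typeI {ν T : ℝ} (hν : 0 < ν) (hT : 0 < T)
    {u : ℝ → EuclideanSpace ℝ (Fin 3) → EuclideanSpace ℝ (Fin 3)} {p : ℝ → EuclideanSpace ℝ (Fin 3) → ℝ}
    (hsol : IsClassicalNSSolutionOn (Ico 0 T) ν 0 u p) (hLH : IsLerayHopfOn T ν 0 (u 0) u)
    (hdec : HasRapidSpatialDecay (u 0))
    (hslab : ∀ T' < T, ∃ M : ℝ, ∀ t ∈ Icc 0 T', ∀ x, ‖u t x‖ ≤ M)
    (hI : IsTypeIBlowup u T) (hext : ¬ HasSmoothExtensionPast ν 0 u T)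
    {lam0 R0 θ : ℝ} (hlam01 : lam0 < 1) (hR0 : 0 < R0) (hθ : θ < 1)
    {hs : ℕ → ℝ} (hhs : ∀ k, 0 < hs k) (hhs0 : Tendsto hs atTop (𝓝 0))
    (hW : ∀ κ : ℝ, 0 < κ → ∀ q : ℝ, 0 < q → ∀ ε : ℝ, 0 < ε → ∀ δ : ℝ, 0 < δ → ∃ M : ℝ, 0 < M ∧
      ∃ E : Set ℝ, (∀ k, volume (E ∩ Set.Ioo (T - hs k) T) ≤ ENNReal.ofReal (θ * hs k)) ∧
      ∀ t ∈ Set.Ico 0 T, t ∉ E → ∀ x : EuclideanSpace ℝ (Fin 3), M ≤ ‖curl (u t) x‖ →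
        κ / (T - t) ≤ ‖curl (u t) x‖ → (∀ x' : EuclideanSpace ℝ (Fin 3), q * ‖curl (u t) x'‖ ≤ ‖curl (u t) x‖) →
          MeasureTheory.volume {y : EuclideanSpace ℝ (Fin 3) | lam0 * ‖curl (u t) x‖ ≤ ‖curl (u t) y‖ ∧
              ‖x - y‖ ≤ R0 * Real.sqrt (ν / ‖curl (u t) x‖) ∧
              ε < Real.sqrt (1 - (inner ℝ (‖curl (u t) x‖⁻¹ • curl (u t) x)
                (‖curl (u t) y‖⁻¹ • curl (u t) y)) ^ 2)}
            ≤ ENNReal.ofReal (δ * Real.sqrt (ν / ‖curl (u t) x‖) ^ 3)) : False := by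
  classical
  -- Step 0: drop the early scales with `h_k ≥ T`; base times `τ_k = T − h_{k+k₀}`
  obtain ⟨k₀, hk₀⟩ := eventually_atTop.1 (hhs0.eventually_lt_const hT)
  set τ : ℕ → ℝ := fun k => T - hs (k + k₀) with hτdef
  have hτ : ∀ k, τ k ∈ Ico 0 T := fun k =>
    ⟨by have := hk₀ (k + k₀) (Nat.le_add_left _ _); rw [hτdef]; linarith,
     by have := hhs (k + k₀); rw [hτdef]; linarith⟩
  have hτT : Tendsto τ atTop (𝓝 T) := by
    have h := (hhs0.comp (tendsto_add_atTop_nat k₀)).const_sub T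
    rw [sub_zero] at h
    exact h
  -- Step 1: the flexible zoom at the caller's base times
  obtain ⟨φ, hφ, C, W, xc, lam, hWcl, hW0, hlam, hlam2, hlam0, -, hflex⟩ :=
    typeIZoom_ancientMild_limit_flexible hν hT hsol hLH hslab hI hext hτ hτT
  have hμeq : ∀ j, lam j ^ 2 / ν = hs (φ j + k₀) := fun j => by
    rw [hlam2 j, hτdef]; field_simp; ring
  -- the upper Type-I law for the vorticity near `T`
  obtain ⟨Cω, tω, htω, hCω⟩ := upper_vorticity_rate hν hT hsol hLH hdec hI
  set C' : ℝ := max Cω 1 with hC'def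
  have hC' : 0 < C' := lt_of_lt_of_le one_pos (le_max_right _ _)
  have hCω' : ∀ t ∈ Ico tω T, ∀ x, ‖curl (u t) x‖ ≤ C' / (T - t) := fun t ht x =>
    (hCω t ht x).trans (div_le_div_of_nonneg_right (le_max_left _ _) (sub_pos.2 ht.2).le)
  -- Step 2: every slice `s ∈ [-1, 0)` has non-zero vorticity (backward uniqueness + `W(-1,0) ≠ 0`)
  have hnz : ∀ s, -1 ≤ s → s < 0 → ∃ y, curl (W s) y ≠ 0 := by
    intro s hs1 hs0
    by_contra h
    push Not at h
    have hc1 : ∀ x, curl (W (-1)) x = 0 := by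
      rcases eq_or_lt_of_le hs1 with h1 | h1
      · rw [h1]; exact h
      · exact curl_eq_zero_of_curl_slice_eq_zero hWcl hs0 h h1
    exact hW0 (slice_eq_zero_of_curl_slice_eq_zero hWcl (by norm_num) hc1 0)
  -- Step 3: the FIXED slice interval `[a, b] = [-1, -1/N]`, `N = (3 - θ)/(1 - θ)`, and the floor
  have h1θ : 0 < 1 - θ := by linarith
  set N : ℝ := 2 / (1 - θ) + 1 with hNdef
  have hN1 : 1 < N := by
    have : 0 < 2 / (1 - θ) := div_pos two_pos h1θ
    rw [hNdef]; linarith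
  have hN0 : 0 < N := lt_trans one_pos hN1
  set B : ℝ := 1 / N with hBdef
  have hB : 0 < B := by rw [hBdef]; exact div_pos one_pos hN0
  have hB1 : B < 1 := by rw [hBdef]; exact (div_lt_one hN0).2 hN1
  have h3ne : (3 : ℝ) - θ ≠ 0 := ne_of_gt (by linarith)
  have h1ne : (1 : ℝ) - θ ≠ 0 := h1θ.ne'
  have hBθ : B = (1 - θ) / (3 - θ) := by
    rw [hBdef, hNdef, div_add_one h1ne, one_div_div]
    congr 1; ring
  set b : ℝ := -B with hbdef
  set a : ℝ := (-1 : ℝ) with hadef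
  have hb0 : b < 0 := by rw [hbdef]; linarith
  have hab : a < b := by rw [hadef, hbdef]; linarith
  have hθab : θ * (-a) < b - a := by
    have h3 : 0 < 3 - θ := by linarith
    have key : θ * (3 - θ) < 2 := by nlinarith [mul_pos h1θ (show (0 : ℝ) < 2 - θ by linarith)]
    have h4 : θ < 1 - B := by
      rw [hBθ, show 1 - (1 - θ) / (3 - θ) = 2 / (3 - θ) by field_simp; ring, lt_div_iff₀ h3]
      exact key
    rw [hadef, hbdef]; linarith
  have hIcc : ∀ s ∈ Icc a b, -1 ≤ s ∧ s < 0 := fun s hs' => ⟨by rw [hadef] at hs'; exact hs'.1,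
    lt_of_le_of_lt hs'.2 hb0⟩
  obtain ⟨m, hm, hfloor⟩ := exists_curl_floor_Icc hWcl hb0 fun s hs' => hnz s (hIcc s hs').1 (hIcc s hs').2
  -- the door at `κ₀ = m B`, `q₀ = m B/(2C')`, along the levels `ε_n = δ_n = 1/(n+1)`
  set q₀ : ℝ := m * B / (2 * C') with hq₀def
  have hq₀ : 0 < q₀ := by rw [hq₀def]; positivity
  have hlev : ∀ n : ℕ, ∃ M : ℝ, 0 < M ∧ ∃ E : Set ℝ,
      (∀ k, volume (E ∩ Set.Ioo (T - hs k) T) ≤ ENNReal.ofReal (θ * hs k)) ∧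
      ∀ t ∈ Set.Ico 0 T, t ∉ E → ∀ x : EuclideanSpace ℝ (Fin 3), M ≤ ‖curl (u t) x‖ →
        m * B / (T - t) ≤ ‖curl (u t) x‖ →
        (∀ x' : EuclideanSpace ℝ (Fin 3), q₀ * ‖curl (u t) x'‖ ≤ ‖curl (u t) x‖) →
          volume {y : EuclideanSpace ℝ (Fin 3) | lam0 * ‖curl (u t) x‖ ≤ ‖curl (u t) y‖ ∧
              ‖x - y‖ ≤ R0 * Real.sqrt (ν / ‖curl (u t) x‖) ∧
              1 / ((n : ℝ) + 1) < Real.sqrt (1 - (inner ℝ (‖curl (u t) x‖⁻¹ • curl (u t) x)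
                (‖curl (u t) y‖⁻¹ • curl (u t) y)) ^ 2)}
            ≤ ENNReal.ofReal (1 / ((n : ℝ) + 1) * Real.sqrt (ν / ‖curl (u t) x‖) ^ 3) :=
    fun n => hW (m * B) (mul_pos hm hB) q₀ hq₀ (1 / ((n : ℝ) + 1)) (by positivity) (1 / ((n : ℝ) + 1))
      (by positivity)
  choose M hM0 E hE hgoodn using hlev
  -- Step 4a: the diagonal over levels (admissibility = the level is below the zoom amplitude scale)
  set P : ℕ → ℕ → Prop := fun n j => M n * lam j ^ 2 * ((n : ℝ) + 1) ≤ 1 with hPdef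
  have hPev : ∀ n, ∀ᶠ j in atTop, P n j := by
    intro n
    have h2 : Tendsto (fun j => M n * lam j ^ 2 * ((n : ℝ) + 1)) atTop
        (𝓝 (M n * 0 ^ 2 * ((n : ℝ) + 1))) := ((hlam0.pow 2).const_mul (M n)).mul_const _
    rw [zero_pow two_ne_zero, mul_zero, zero_mul] at h2
    filter_upwards [h2.eventually_lt_const one_pos] with j hj2
    exact hj2.le
  have hQev : ∀ n₀ : ℕ, ∀ᶠ j in atTop, ∀ n ∈ Iic n₀, P n j := fun n₀ =>
    (eventually_all_finite (finite_Iic n₀)).2 fun n _ => hPev n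
  set nsel : ℕ → ℕ := fun j => Nat.findGreatest (fun n => ∀ n' ∈ Iic n, P n' j) j with hnseldef
  have hnselP : ∀ᶠ j in atTop, P (nsel j) j := by
    filter_upwards [hQev 0] with j hj
    have hspec : ∀ n' ∈ Iic (nsel j), P n' j :=
      Nat.findGreatest_spec (P := fun n => ∀ n' ∈ Iic n, P n' j) (Nat.zero_le j) hj
    exact hspec (nsel j) (mem_Iic.2 le_rfl)
  have hnsel : Tendsto nsel atTop atTop := by
    refine tendsto_atTop.2 fun n₀ => ?_
    filter_upwards [hQev n₀, eventually_ge_atTop n₀] with j hj hjn₀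
    exact Nat.le_findGreatest (P := fun n => ∀ n' ∈ Iic n, P n' j) hjn₀ hj
  -- Step 4b: slice selection at EVERY scale (the scales are the good ones), then a subsequence
  have hμ : ∀ j, 0 < lam j ^ 2 / ν := fun j => div_pos (pow_pos (hlam j) 2) hν
  have hma1 : -a = 1 := by rw [hadef]; norm_num
  have hsel : ∀ j, ∃ s, s ∈ Icc a b ∧
      T + lam j ^ 2 * s / ν ∉ E (nsel j) ∧ T + lam j ^ 2 * s / ν ∈ Ico 0 T := by
    intro j
    have hEj : volume (E (nsel j) ∩ Ioo (T - lam j ^ 2 / ν * (-a)) T) ≤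
        ENNReal.ofReal (θ * (lam j ^ 2 / ν * (-a))) := by
      rw [hma1, mul_one, hμeq j]; exact hE (nsel j) (φ j + k₀)
    obtain ⟨s, hs', hsE⟩ := exists_slice_time_notMem_scale (T := T) (hμ j) hab hb0 hθab hEj
    have e : T + lam j ^ 2 / ν * s = T + lam j ^ 2 * s / ν := by ring
    refine ⟨s, Ioc_subset_Icc_self hs', by rwa [e] at hsE, ?_, ?_⟩
    · have h1 : lam j ^ 2 / ν * a ≤ lam j ^ 2 / ν * s := mul_le_mul_of_nonneg_left hs'.1.le (hμ j).le
      have h2 : lam j ^ 2 / ν < T := by rw [hμeq j]; exact hk₀ _ (Nat.le_add_left _ _)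
      rw [← e, hadef] at *; nlinarith
    · have h1 : lam j ^ 2 / ν * s < 0 := mul_neg_of_pos_of_neg (hμ j) (lt_of_le_of_lt hs'.2 hb0)
      rw [← e]; linarith
  choose σ hσmem hσgood using hsel
  obtain ⟨sStar, hsStar, ψ, hψ, hσlim⟩ := isCompact_Icc.tendsto_subseq hσmem
  have hsStar0 : sStar < 0 := lt_of_le_of_lt hsStar.2 hb0
  obtain ⟨j₀, hj₀⟩ := eventually_atTop.1 hnselP
  set k : ℕ → ℕ := fun i => ψ (i + j₀) with hkdef
  have hk : StrictMono k := fun i i' h => hψ (Nat.add_lt_add_right h j₀)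
  have hkj₀ : ∀ i, j₀ ≤ k i := fun i =>
    le_trans (Nat.le_add_left j₀ i) (hψ.id_le (i + j₀))
  have hPk : ∀ i, P (nsel (k i)) (k i) := fun i => hj₀ _ (hkj₀ i)
  have hgood : ∀ i, T + lam (k i) ^ 2 * σ (k i) / ν ∉ E (nsel (k i)) ∧
      T + lam (k i) ^ 2 * σ (k i) / ν ∈ Ico 0 T := fun i => hσgood (k i)
  have hnk : Tendsto (fun i => nsel (k i)) atTop atTop := hnsel.comp hk.tendsto_atTop
  have hlev0 : Tendsto (fun i => 1 / ((nsel (k i) : ℝ) + 1)) atTop (𝓝 0) :=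
    (tendsto_one_div_add_atTop_nhds_zero_nat (𝕜 := ℝ)).comp hnk
  have hσk : Tendsto (fun i => σ (k i)) atTop (𝓝 sStar) := hσlim.comp (tendsto_add_atTop_nat j₀)
  have htT : Tendsto (fun i => T + lam (k i) ^ 2 * σ (k i) / ν) atTop (𝓝 T) := by
    have h1 : Tendsto (fun i => T + lam (k i) ^ 2 * σ (k i) / ν) atTop (𝓝 (T + 0 ^ 2 * sStar / ν)) :=
      ((((hlam0.comp hk.tendsto_atTop).pow 2).mul hσk).div_const ν).const_add T
    rw [zero_pow two_ne_zero, zero_mul, zero_div, add_zero] at h1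
    exact h1
  -- diagonal convergence along `k` (extend the slices off the range of `k` by `s⋆`)
  set Ω : EuclideanSpace ℝ (Fin 3) → EuclideanSpace ℝ (Fin 3) := curl (W sStar) with hΩdef
  have hconv : ∀ y, Tendsto (fun i => (lam (k i) ^ 2 / ν) •
      curl (u (T + lam (k i) ^ 2 * σ (k i) / ν)) (xc (k i) + lam (k i) • y)) atTop (𝓝 (Ω y)) := by
    intro y
    set σ' : ℕ → ℝ := Function.extend k (fun i => σ (k i)) fun _ => sStar with hσ'def
    have hσ' : Tendsto σ' atTop (𝓝 sStar) := tendsto_extend_of_strictMono hk hσk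
    have h := (hflex sStar hsStar0 σ' hσ' y).comp hk.tendsto_atTop
    refine h.congr fun i => ?_
    simp only [comp_apply, hσ'def, hk.injective.extend_apply]
  -- Step 5: the window lemma (door read at the preimages of `y₀`), then rigidity
  obtain ⟨y₀, hy₀m⟩ := hfloor sStar hsStar
  have hy₀ : Ω y₀ ≠ 0 := by
    rw [hΩdef]; exact norm_pos_iff.1 (hm.trans hy₀m)
  have hΩc : Continuous Ω :=
    continuous_curl ((hWcl.contDiff_slice hsStar0).of_le (by exact_mod_cast le_top))
  -- eventually the preimage of `y₀` carries vorticity `> ν m/λ²`, hence both near-maximum premises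
  have hbig : ∀ᶠ i in atTop, m < ‖(lam (k i) ^ 2 / ν) •
      curl (u (T + lam (k i) ^ 2 * σ (k i) / ν)) (xc (k i) + lam (k i) • y₀)‖ :=
    (hconv y₀).norm.eventually_const_lt hy₀m
  have hlate : ∀ᶠ i in atTop, tω < T + lam (k i) ^ 2 * σ (k i) / ν := htT.eventually_const_lt htω.2
  have hWseq : ∀ ε : ℝ, 0 < ε → ∀ δ : ℝ, 0 < δ → ∃ Ms : ℕ → ℝ,
      Tendsto (fun i => Ms i * lam (k i) ^ 2) atTop (𝓝 0) ∧ ∀ᶠ i in atTop,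
      Ms i ≤ ‖curl (u (T + lam (k i) ^ 2 * σ (k i) / ν)) (xc (k i) + lam (k i) • y₀)‖ →
        volume {y : EuclideanSpace ℝ (Fin 3) |
            lam0 * ‖curl (u (T + lam (k i) ^ 2 * σ (k i) / ν)) (xc (k i) + lam (k i) • y₀)‖ ≤
              ‖curl (u (T + lam (k i) ^ 2 * σ (k i) / ν)) y‖ ∧
            ‖(xc (k i) + lam (k i) • y₀) - y‖ ≤
              R0 * Real.sqrt (ν / ‖curl (u (T + lam (k i) ^ 2 * σ (k i) / ν)) (xc (k i) + lam (k i) • y₀)‖) ∧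
            ε < Real.sqrt (1 - (inner ℝ
              (‖curl (u (T + lam (k i) ^ 2 * σ (k i) / ν)) (xc (k i) + lam (k i) • y₀)‖⁻¹ •
                curl (u (T + lam (k i) ^ 2 * σ (k i) / ν)) (xc (k i) + lam (k i) • y₀))
              (‖curl (u (T + lam (k i) ^ 2 * σ (k i) / ν)) y‖⁻¹ •
                curl (u (T + lam (k i) ^ 2 * σ (k i) / ν)) y)) ^ 2)}
          ≤ ENNReal.ofReal (δ * Real.sqrt (ν /
              ‖curl (u (T + lam (k i) ^ 2 * σ (k i) / ν)) (xc (k i) + lam (k i) • y₀)‖) ^ 3) := by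
    intro ε hε δ hδ
    refine ⟨fun i => M (nsel (k i)), ?_, ?_⟩
    · refine squeeze_zero (fun i => (mul_pos (hM0 _) (pow_pos (hlam _) 2)).le) (fun i => ?_) hlev0
      have hP2 := hPk i
      have hn : (0 : ℝ) < (nsel (k i) : ℝ) + 1 := by positivity
      show M (nsel (k i)) * lam (k i) ^ 2 ≤ 1 / ((nsel (k i) : ℝ) + 1)
      rw [le_div_iff₀ hn]; exact hP2
    · filter_upwards [hlev0.eventually (Iic_mem_nhds hε), hlev0.eventually (Iic_mem_nhds hδ), hbig, hlate]
        with i hiε hiδ hib hil hMx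
      -- shorthand
      set tt : ℝ := T + lam (k i) ^ 2 * σ (k i) / ν with htt
      set Pt : EuclideanSpace ℝ (Fin 3) := xc (k i) + lam (k i) • y₀ with hPt
      have hTt : 0 < T - tt := sub_pos.2 (hgood i).2.2
      have hl2 : 0 < lam (k i) ^ 2 := pow_pos (hlam (k i)) 2
      have hTteq : T - tt = lam (k i) ^ 2 * (-σ (k i)) / ν := by rw [htt]; ring
      have hσB : B ≤ -σ (k i) := by linarith [(hσmem (k i)).2, hbdef]
      -- `m B < |ω(tt, Pt)| (T - tt)`
      have hωT : m * B < ‖curl (u tt) Pt‖ * (T - tt) := by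
        have h1 : m < lam (k i) ^ 2 / ν * ‖curl (u tt) Pt‖ := by
          have := hib
          rwa [norm_smul, Real.norm_of_nonneg (hμ (k i)).le] at this
        have h2 : lam (k i) ^ 2 / ν * ‖curl (u tt) Pt‖ * B ≤ ‖curl (u tt) Pt‖ * (T - tt) := by
          rw [hTteq]
          have : lam (k i) ^ 2 / ν * ‖curl (u tt) Pt‖ * B
              = ‖curl (u tt) Pt‖ * (lam (k i) ^ 2 * B / ν) := by ring
          rw [this]
          refine mul_le_mul_of_nonneg_left ?_ (norm_nonneg _)
          exact div_le_div_of_nonneg_right (mul_le_mul_of_nonneg_left hσB hl2.le) hν.le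
        nlinarith [mul_lt_mul_of_pos_right h1 hB]
      have hκ : m * B / (T - tt) ≤ ‖curl (u tt) Pt‖ := by
        rw [div_le_iff₀ hTt]; exact hωT.le
      have hq : ∀ x' : EuclideanSpace ℝ (Fin 3), q₀ * ‖curl (u tt) x'‖ ≤ ‖curl (u tt) Pt‖ := by
        intro x'
        have h1 : ‖curl (u tt) x'‖ ≤ C' / (T - tt) := hCω' tt ⟨hil.le, (hgood i).2.2⟩ x'
        have h2 : q₀ * (C' / (T - tt)) = m * B / 2 / (T - tt) := by
          rw [hq₀def]; field_simp
        calc q₀ * ‖curl (u tt) x'‖ ≤ q₀ * (C' / (T - tt)) := mul_le_mul_of_nonneg_left h1 hq₀.le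
          _ = m * B / 2 / (T - tt) := h2
          _ ≤ ‖curl (u tt) Pt‖ := by
              rw [div_le_iff₀ hTt]; nlinarith [mul_pos hm hB]
      have hbnd := hgoodn (nsel (k i)) tt (hgood i).2 (hgood i).1 Pt hMx hκ hq
      refine le_trans (measure_mono fun y hy => ?_) (le_trans hbnd (ENNReal.ofReal_le_ofReal ?_))
      · obtain ⟨h1, h2, h3⟩ := hy
        exact ⟨h1, h2, lt_of_le_of_lt hiε h3⟩
      · exact mul_le_mul_of_nonneg_right hiδ (pow_nonneg (Real.sqrt_nonneg _) 3)
  obtain ⟨U, hUo, hy₀U, hal⟩ := exists_window_cross_eq_zero_of_windowBulkAligned_at hν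
    (ω := fun t => curl (u t)) (t := fun i => T + lam (k i) ^ 2 * σ (k i) / ν)
    (xc := fun i => xc (k i)) (lam := fun i => lam (k i)) hlam01 hR0 (fun i => hlam (k i))
    hWseq hΩc hconv hy₀
  exact hW0 (eq_zero_of_aligned_window hWcl.hasTypeITimeDecay hWcl.continuousOn_uncurry
    (fun s t hst ht' x => hWcl.mild_eq_heatExtension hst ht' x) (fun t ht' => hWcl.isDivFree ht')
    hsStar0 hy₀ hUo ⟨y₀, hy₀U⟩ hal (-1) (by norm_num) 0)


/-- **Bridge: the scale-sequence near-maximum window-bulk door plus NoTypeII gives Clay (A)** (per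
solution: `λ₀ < 1`, `R₀ > 0`, `θ < 1` and good final scales `h_k → 0⁺`, then for all `κ, q, ε, δ > 0` a
level `M` and a time set `E` with `|E ∩ (T−h_k,T)| ≤ θ h_k` for all `k`, outside which the window-bulk
bound holds at rate- and relative-near-maximum points; with NoTypeII: `NavierStokesRegularity`).
[cite: GigaMiura2011, Thm 1.1 with Rmk 1.4 and §2.1] -/
theorem navierStokesRegularity_of_scaleSeqNearMaxBulkAlignment_of_noTypeII
    (hW : ∀ (ν T : ℝ), 0 < ν → 0 < T → ∀ (u : ℝ → EuclideanSpace ℝ (Fin 3) → EuclideanSpace ℝ (Fin 3))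
      (p : ℝ → EuclideanSpace ℝ (Fin 3) → ℝ), IsClassicalNSSolutionOn (Set.Ico 0 T) ν 0 u p →
      IsLerayHopfOn T ν 0 (u 0) u → HasRapidSpatialDecay (u 0) →
      ∃ lam0 : ℝ, lam0 < 1 ∧ ∃ R0 : ℝ, 0 < R0 ∧ ∃ θ : ℝ, θ < 1 ∧ ∃ hs : ℕ → ℝ, (∀ k, 0 < hs k) ∧
        Filter.Tendsto hs Filter.atTop (nhds 0) ∧ ∀ κ : ℝ, 0 < κ → ∀ q : ℝ, 0 < q →
        ∀ ε : ℝ, 0 < ε → ∀ δ : ℝ, 0 < δ → ∃ M : ℝ, 0 < M ∧ ∃ E : Set ℝ,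
        (∀ k, MeasureTheory.volume (E ∩ Set.Ioo (T - hs k) T) ≤ ENNReal.ofReal (θ * hs k)) ∧
        ∀ t ∈ Set.Ico 0 T, t ∉ E → ∀ x : EuclideanSpace ℝ (Fin 3), M ≤ ‖curl (u t) x‖ →
        κ / (T - t) ≤ ‖curl (u t) x‖ → (∀ x' : EuclideanSpace ℝ (Fin 3), q * ‖curl (u t) x'‖ ≤ ‖curl (u t) x‖) →
          MeasureTheory.volume {y : EuclideanSpace ℝ (Fin 3) | lam0 * ‖curl (u t) x‖ ≤ ‖curl (u t) y‖ ∧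
              ‖x - y‖ ≤ R0 * Real.sqrt (ν / ‖curl (u t) x‖) ∧
              ε < Real.sqrt (1 - (inner ℝ (‖curl (u t) x‖⁻¹ • curl (u t) x)
                (‖curl (u t) y‖⁻¹ • curl (u t) y)) ^ 2)}
            ≤ ENNReal.ofReal (δ * Real.sqrt (ν / ‖curl (u t) x‖) ^ 3))
    (hII : ∀ (ν T : ℝ), 0 < ν → 0 < T → ∀ (u : ℝ → EuclideanSpace ℝ (Fin 3) → EuclideanSpace ℝ (Fin 3))
      (p : ℝ → EuclideanSpace ℝ (Fin 3) → ℝ), IsMaximalSmoothSolution ν 0 u p T →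
      IsLerayHopfOn T ν 0 (u 0) u → HasRapidSpatialDecay (u 0) → IsTypeIBlowup u T) :
    NavierStokesRegularity := by
  apply Summit.NavierStokesRegularity.NavierStokesRegularity.Theses.TypeILiouville.Assembly_holds
  intro ν T hν hT u p hcl hLH hdec
  by_contra hext
  have hI : IsTypeIBlowup u T := hII ν T hν hT u p ⟨hcl, hext⟩ hLH hdec
  have hbdd : ∀ T' < T, ∃ M : ℝ, ∀ s ∈ Set.Icc 0 T', ∀ x, ‖u s x‖ ≤ M := by
    intro T' hT'
    by_cases h : 0 < T'
    · exact liouvilleKillsTypeI_exists_bound_Icc hν hcl hLH hdec ⟨h, hT'⟩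
    · obtain ⟨M, hM⟩ := liouvilleKillsTypeI_exists_bound_Icc hν hcl hLH hdec (T' := T / 2)
        ⟨by linarith, by linarith⟩
      push Not at h
      exact ⟨M, fun s hs x => hM s ⟨hs.1, by linarith [hs.2]⟩ x⟩
  obtain ⟨lam0, hlam01, R0, hR0, θ, hθ, hs, hhs, hhs0, hfam⟩ := hW ν T hν hT u p hcl hLH hdec
  exact false_of_scaleSeqNearMaxBulkAligned_typeI hν hT hcl hLH hdec hbdd hI hext hlam01 hR0 hθ hhs hhs0 hfam
end Summit.NavierStokesRegularity.NavierStokesRegularity.Theorems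
end
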